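import Summits.AnomalousDissipation.AnomalousDissipation.Theorems.QuarticLadderQuarticGateCubicKernel
import Summits.AnomalousDissipation.AnomalousDissipation.Theorems.MomentParityQuarticGateAssembly
import Summits.AnomalousDissipation.AnomalousDissipation.Theorems.MomentParityQuarticGateEnstrophy
import Summits.AnomalousDissipation.AnomalousDissipation.Theorems.MomentParityQuarticGateRealize
import Summits.AnomalousDissipation.AnomalousDissipation.Theorems.MomentParityQuarticGateRowPoly
import Summits.AnomalousDissipation.AnomalousDissipation.Theorems.MomentParityQuarticGateSlater
import Summits.AnomalousDissipation.AnomalousDissipation.Theorems.MomentParityQuarticGateDefectCertificate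

/-!
# Cubic-row surgery for the crux `QuarticGate` (stmt-AnomalousDissipation-11464), line
# `dissipative-tower`, stub S7 `stub_cubicRowSurgery` — part II: rows in coordinates, assembly

From a level-`N` law `μ₁` with finite fourth moments, Slater in degree `4`, 3-stationary for Galerkin
NS at `(ν, f, N)`, at a level without dissipative towers (hypothesis T of the line), we produce `μ₂`
with the same properties, the same mean energy and dissipation, and IN ADDITION vanishing rows of all
homogeneous cubic Casimirs. `row_eq_eval_basis`: in an orthonormal band basis the row of a test over
the basis is the evaluation of `Σᵢ ∂ᵢP · (R₀ i + R₁ i + R₂ i)` (force / viscous / Euler rows,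
`nsGeneratorPairing_eq_of_level`). `cubicRowSurgery_basis`: coordinate moments of `μ₁` are Slater
(`isStrictlyKPositive_of_slater`), quadratic rows vanish (3-stationarity), the no-tower hypothesis
transports to polynomials (`exists_level_of_coords`); the KERNEL `exists_cubicShift` (part I) gives
the shifted sequence, REALIZED by `exists_measure_of_strictlyKPositive`; degree-`≤ 2` rows, energy and
dissipation are unchanged (bookkeeping of the landed `order3Surgery_of`). `stub_cubicRowSurgery`: the
registered stub (basis from `exists_bandBasis`).
-/

-- `Summit.<Summit>.<Problem>`: mandated summit-side namespace (CONVENTIONS §2), duplicate deliberate.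
set_option linter.dupNamespace false

namespace Summit.AnomalousDissipation.AnomalousDissipation.Theorems.QuarticLadderQuarticGate

open scoped BigOperators InnerProductSpace RealInnerProductSpace ENNReal
open MeasureTheory MvPolynomial Literature.MeasureTheory.Moments
open Literature.Analysis.FunctionSpaces Literature.Analysis.FluidPDE
open Summit.AnomalousDissipation.AnomalousDissipation.Theorems.QuarticGate.Negative
open Summit.AnomalousDissipation.AnomalousDissipation.Theorems.MomentParityQuarticGate

variable {N n : ℕ} {b : Fin n → UnitAddTorus (Fin 3) → EuclideanSpace ℝ (Fin 3)}

/-- **The row of a test over an orthonormal band basis, in coordinates.** For band tests `bᵢ` with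
the truncation formula, a smooth force `f` and a level-`N` field `u` with coordinates `x`:
`⟨F(u), ∇p(u)⟩ = (Σᵢ ∂ᵢP · (C (f,bᵢ) + Σⱼ C (ν (bⱼ,Δbᵢ)) Xⱼ + Σⱼ Σₖ Xⱼ Xₖ C ∫⟪Dbᵢ bⱼ, bₖ⟫))(x)`.
[folklore] -/
theorem row_eq_eval_basis (hb : ∀ i, IsBandTest N (b i))
    (hbs : ∀ u : Torus.energySpace (Fin 3), IsLevel N u →
      ∀ x, Torus.fourierTruncate N (u.1 : UnitAddTorus (Fin 3) → EuclideanSpace ℝ (Fin 3)) x =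
        ∑ i, Torus.pairing u.1 (b i) • b i x)
    (ν : ℝ) {f : UnitAddTorus (Fin 3) → EuclideanSpace ℝ (Fin 3)} (hf : Torus.IsSmooth f)
    (P : MvPolynomial (Fin n) ℝ) (u : Torus.energySpace (Fin 3)) (hu : IsLevel N u) :
    Torus.nsGeneratorPairing ν f u (polyGrad b P u) =
      eval (fun i => Torus.pairing u.1 (b i))
        (∑ i, pderiv i P *
          (C (∫ y, ⟪f y, b i y⟫_ℝ) +
            ∑ j, C (ν * ∫ y, ⟪b j y, Torus.laplacian (b i) y⟫_ℝ) * X j +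
            ∑ j, ∑ k, X j * (X k * C (∫ y, ⟪Torus.fderiv (b i) y (b j y), b k y⟫_ℝ)))) := by
  rw [nsGeneratorPairing_polyGrad_eq_sum hb ν hf.integrable P u, map_sum]
  refine Finset.sum_congr rfl fun i _ => ?_
  rw [map_mul, nsGeneratorPairing_eq_of_level hb hbs ν f (hb i).1 u hu]
  simp only [map_add, map_mul, map_sum, eval_C, eval_X]
  congr 1
  congr 2
  rw [Finset.mul_sum]
  exact Finset.sum_congr rfl fun j _ => by ring

/-- **Cubic-row surgery over an orthonormal band basis** (the content of `stub_cubicRowSurgery`, with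
the basis data explicit and the no-tower hypothesis already specialised to tests over the basis).
[folklore] -/
theorem cubicRowSurgery_basis (hb : ∀ i, IsBandTest N (b i))
    (hbo : ∀ i j, ∫ x, ⟪b i x, b j x⟫_ℝ = if i = j then (1 : ℝ) else 0)
    (hbs : ∀ u : Torus.energySpace (Fin 3), IsLevel N u →
      ∀ x, Torus.fourierTruncate N (u.1 : UnitAddTorus (Fin 3) → EuclideanSpace ℝ (Fin 3)) x =
        ∑ i, Torus.pairing u.1 (b i) • b i x)
    (ν : ℝ) {f : UnitAddTorus (Fin 3) → EuclideanSpace ℝ (Fin 3)} (hf : Torus.IsSmooth f)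
    (μ₁ : Measure (Torus.energySpace (Fin 3))) [IsProbabilityMeasure μ₁]
    (hl₁ : ∀ᵐ u ∂μ₁, IsLevel N u)
    (h4 : Integrable (fun u : Torus.energySpace (Fin 3) => ‖u‖ ^ 4) μ₁)
    (hSl : ∀ (m : ℕ) (g : Fin m → UnitAddTorus (Fin 3) → EuclideanSpace ℝ (Fin 3))
      (P : MvPolynomial (Fin m) ℝ), (∀ i, IsBandTest N (g i)) → P.totalDegree ≤ 4 →
      (∀ u : Torus.energySpace (Fin 3), IsLevel N u →
        0 ≤ MvPolynomial.eval (fun j => Torus.pairing u.1 (g j)) P) →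
      (∃ u : Torus.energySpace (Fin 3), IsLevel N u ∧
        MvPolynomial.eval (fun j => Torus.pairing u.1 (g j)) P ≠ 0) →
      0 < ∫ u, MvPolynomial.eval (fun j => Torus.pairing u.1 (g j)) P ∂μ₁)
    (hst : IsPolyStationary ν f N 3 μ₁)
    (hT : ∀ P Q : MvPolynomial (Fin n) ℝ, P.IsHomogeneous 2 → Q.IsHomogeneous 3 →
      (∀ u : Torus.energySpace (Fin 3), IsLevel N u →
        Torus.nsGeneratorPairing (d := Fin 3) 0 0 u (polyGrad b Q u) = 0) →
      (∀ u : Torus.energySpace (Fin 3), IsLevel N u →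
        Torus.nsGeneratorPairing (d := Fin 3) 0 0 u (polyGrad b P u) =
          Torus.nsGeneratorPairing (d := Fin 3) ν 0 u (polyGrad b Q u)) →
      ∀ u : Torus.energySpace (Fin 3), IsLevel N u →
        MvPolynomial.eval (fun j => Torus.pairing u.1 (b j)) Q = 0) :
    ∃ μ₂ : Measure (Torus.energySpace (Fin 3)), IsProbabilityMeasure μ₂ ∧ (∀ᵐ u ∂μ₂, IsLevel N u) ∧
      Integrable (fun u : Torus.energySpace (Fin 3) => ‖u‖ ^ 4) μ₂ ∧
      (∀ (m : ℕ) (g : Fin m → UnitAddTorus (Fin 3) → EuclideanSpace ℝ (Fin 3))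
        (P : MvPolynomial (Fin m) ℝ), (∀ i, IsBandTest N (g i)) → P.totalDegree ≤ 4 →
        (∀ u : Torus.energySpace (Fin 3), IsLevel N u →
          0 ≤ MvPolynomial.eval (fun j => Torus.pairing u.1 (g j)) P) →
        (∃ u : Torus.energySpace (Fin 3), IsLevel N u ∧
          MvPolynomial.eval (fun j => Torus.pairing u.1 (g j)) P ≠ 0) →
        0 < ∫ u, MvPolynomial.eval (fun j => Torus.pairing u.1 (g j)) P ∂μ₂) ∧
      IsPolyStationary ν f N 3 μ₂ ∧
      (∀ (m : ℕ) (g : Fin m → UnitAddTorus (Fin 3) → EuclideanSpace ℝ (Fin 3))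
        (P : MvPolynomial (Fin m) ℝ), (∀ i, IsBandTest N (g i)) → P.IsHomogeneous 3 →
        (∀ u : Torus.energySpace (Fin 3), IsLevel N u →
          Torus.nsGeneratorPairing (d := Fin 3) 0 0 u (polyGrad g P u) = 0) →
        Integrable (fun u : Torus.energySpace (Fin 3) =>
          Torus.nsGeneratorPairing ν f u (polyGrad g P u)) μ₂ ∧
        ∫ u, Torus.nsGeneratorPairing ν f u (polyGrad g P u) ∂μ₂ = 0) ∧
      Torus.ensembleEnergy μ₂ = Torus.ensembleEnergy μ₁ ∧
      Torus.ensembleDissipation ν μ₂ = Torus.ensembleDissipation ν μ₁ := by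
  classical
  have hbs' : ∀ i, Torus.IsSmooth (b i) := fun i => (hb i).1
  -- the three families of row polynomials (force, viscous, Euler)
  obtain ⟨R₀, hR₀def⟩ : ∃ R₀ : Fin n → MvPolynomial (Fin n) ℝ,
      R₀ = fun i => C (∫ y, ⟪f y, b i y⟫_ℝ) := ⟨_, rfl⟩
  obtain ⟨R₁, hR₁def⟩ : ∃ R₁ : Fin n → MvPolynomial (Fin n) ℝ,
      R₁ = fun i => ∑ j, C (ν * ∫ y, ⟪b j y, Torus.laplacian (b i) y⟫_ℝ) * X j := ⟨_, rfl⟩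
  obtain ⟨R₂, hR₂def⟩ : ∃ R₂ : Fin n → MvPolynomial (Fin n) ℝ,
      R₂ = fun i => ∑ j, ∑ k, X j * (X k * C (∫ y, ⟪Torus.fderiv (b i) y (b j y), b k y⟫_ℝ)) :=
    ⟨_, rfl⟩
  have hR₀ : ∀ i, (R₀ i).IsHomogeneous 0 := fun i => by
    rw [hR₀def]
    exact isHomogeneous_C _ _
  have hR₁ : ∀ i, (R₁ i).IsHomogeneous 1 := fun i => by
    rw [hR₁def]
    exact isHomogeneous_sum_C_mul_X _ _ id
  have hR₂ : ∀ i, (R₂ i).IsHomogeneous 2 := fun i => by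
    rw [hR₂def]
    exact isHomogeneous_sum_X_mul_X_mul_C _ id
  -- (R1) rows on level-`N` fields, for arbitrary viscosity and force
  have hrowR : ∀ (P : MvPolynomial (Fin n) ℝ) (u : Torus.energySpace (Fin 3)), IsLevel N u →
      Torus.nsGeneratorPairing ν f u (polyGrad b P u) =
        eval (fun i => Torus.pairing u.1 (b i)) (∑ i, pderiv i P * (R₀ i + R₁ i + R₂ i)) := by
    intro P u hu
    rw [row_eq_eval_basis hb hbs ν hf P u hu, hR₀def, hR₁def, hR₂def]
  have hz : Torus.IsSmooth (0 : UnitAddTorus (Fin 3) → EuclideanSpace ℝ (Fin 3)) :=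
    Torus.isSmooth_const 0
  have hvisR : ∀ (P : MvPolynomial (Fin n) ℝ) (u : Torus.energySpace (Fin 3)), IsLevel N u →
      Torus.nsGeneratorPairing (d := Fin 3) ν 0 u (polyGrad b P u) =
        eval (fun i => Torus.pairing u.1 (b i)) (∑ i, pderiv i P * (R₁ i + R₂ i)) := by
    intro P u hu
    rw [row_eq_eval_basis hb hbs ν hz P u hu, hR₁def, hR₂def]
    simp only [Pi.zero_apply, inner_zero_left, integral_zero, map_zero, zero_add]
  have heulR : ∀ (P : MvPolynomial (Fin n) ℝ) (u : Torus.energySpace (Fin 3)), IsLevel N u →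
      Torus.nsGeneratorPairing (d := Fin 3) 0 0 u (polyGrad b P u) =
        eval (fun i => Torus.pairing u.1 (b i)) (∑ i, pderiv i P * R₂ i) := by
    intro P u hu
    rw [row_eq_eval_basis hb hbs 0 hz P u hu, hR₂def]
    simp only [Pi.zero_apply, inner_zero_left, integral_zero, map_zero, zero_add, zero_mul,
      Finset.sum_const_zero]
  -- (0) coordinate moments of `μ₁`: Slater, rows
  obtain ⟨y, hydef⟩ : ∃ y : (Fin n →₀ ℕ) → ℝ,
      y = fun α => ∫ u, ∏ i, (Torus.pairing u.1 (b i)) ^ α i ∂μ₁ := ⟨_, rfl⟩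
  have hmom : ∀ Q : MvPolynomial (Fin n) ℝ, Q.totalDegree ≤ 4 →
      Integrable (fun u : Torus.energySpace (Fin 3) => eval (fun i => Torus.pairing u.1 (b i)) Q) μ₁ ∧
      ∫ u, eval (fun i => Torus.pairing u.1 (b i)) Q ∂μ₁ = rieszFunctional y Q := fun Q hQ => by
    rw [hydef]
    exact integrable_eval_coords_of_four hb hbo h4 Q hQ
  have hy0 : y 0 = 1 := by
    rw [hydef]
    simp
  have hypos : IsStrictlyKPositive (Set.univ : Set (Fin n → ℝ)) 4 y := by
    rw [hydef]
    exact isStrictlyKPositive_of_slater hb hbo μ₁ inferInstance h4 hSl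
  have hlev : ∀ x : Fin n → ℝ, ∃ u : Torus.energySpace (Fin 3), IsLevel N u ∧
      (fun i => Torus.pairing u.1 (b i)) = x := fun x => by
    obtain ⟨u, hu, hux, -, -⟩ := exists_level_of_coords hb hbo x
    exact ⟨u, hu, hux⟩
  -- degree bookkeeping for a row polynomial
  have hRdeg2 : ∀ i, (R₀ i + R₁ i + R₂ i).totalDegree ≤ 2 := fun i =>
    (totalDegree_add _ _).trans (max_le ((totalDegree_add _ _).trans (max_le
      ((hR₀ i).totalDegree_le.trans (by norm_num)) ((hR₁ i).totalDegree_le.trans (by norm_num))))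
      (hR₂ i).totalDegree_le)
  have hRwdeg : ∀ (P : MvPolynomial (Fin n) ℝ) (e : ℕ), P.totalDegree ≤ e + 1 →
      (∑ i, pderiv i P * (R₀ i + R₁ i + R₂ i)).totalDegree ≤ e + 2 := by
    intro P e hP
    refine totalDegree_finsetSum_le fun i _ => (totalDegree_mul _ _).trans ?_
    have h1 := totalDegree_pderiv_le_real i P
    have h2 := hRdeg2 i
    omega
  -- (T) no dissipative tower, polynomial form
  have hTpoly : ∀ P Q : MvPolynomial (Fin n) ℝ, P.IsHomogeneous 2 → Q.IsHomogeneous 3 →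
      (∑ i, pderiv i Q * R₂ i) = 0 → (∑ i, pderiv i P * R₂ i) + (∑ i, pderiv i Q * R₁ i) = 0 →
      Q = 0 := by
    intro P Q hP hQ hE hrel
    have hcas : ∀ u : Torus.energySpace (Fin 3), IsLevel N u →
        Torus.nsGeneratorPairing (d := Fin 3) 0 0 u (polyGrad b Q u) = 0 := fun u hu => by
      rw [heulR Q u hu, hE, map_zero]
    have htow : ∀ u : Torus.energySpace (Fin 3), IsLevel N u →
        Torus.nsGeneratorPairing (d := Fin 3) 0 0 u (polyGrad b (-P) u) =
          Torus.nsGeneratorPairing (d := Fin 3) ν 0 u (polyGrad b Q u) := fun u hu => by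
      have hVE : (∑ i, pderiv i Q * (R₁ i + R₂ i)) = ∑ i, pderiv i (-P) * R₂ i := by
        have h1 : (∑ i, pderiv i Q * (R₁ i + R₂ i)) =
            (∑ i, pderiv i Q * R₁ i) + ∑ i, pderiv i Q * R₂ i := by
          simp only [mul_add, Finset.sum_add_distrib]
        have h2 : (∑ i, pderiv i (-P) * R₂ i) = -∑ i, pderiv i P * R₂ i := by
          simp only [map_neg, neg_mul, Finset.sum_neg_distrib]
        rw [h1, h2, hE, add_zero]
        linear_combination hrel
      rw [heulR (-P) u hu, hvisR Q u hu, hVE]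
    have hPn : (-P).IsHomogeneous 2 := by simpa using hP.neg
    have hvan := hT (-P) Q hPn hQ hcas htow
    refine MvPolynomial.funext fun x => ?_
    obtain ⟨u, hu, hux⟩ := hlev x
    rw [map_zero, ← hux]
    exact hvan u hu
  -- quadratic rows of `y` vanish (3-stationarity of `μ₁`)
  have hrow2 : ∀ P : MvPolynomial (Fin n) ℝ, P.IsHomogeneous 2 →
      rieszFunctional y (∑ i, pderiv i P * (R₀ i + R₁ i + R₂ i)) = 0 := by
    intro P hP
    have hdeg := hRwdeg P 1 (hP.totalDegree_le.trans (by norm_num))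
    rw [← (hmom _ (hdeg.trans (by norm_num))).2,
      ← integral_congr_ae (hl₁.mono fun u hu => hrowR P u hu)]
    exact (hst n b P hb (by have := hP.totalDegree_le; omega)).2
  -- KERNEL and REALIZE
  obtain ⟨y', hy'0, hy'pos, hy'eq, hquad, hcubic⟩ :=
    exists_cubicShift R₀ R₁ R₂ hR₀ hR₁ hR₂ y hy0 hypos hTpoly hrow2
  obtain ⟨μ₂, hp₂, hl₂, hi₂, hint⟩ := exists_measure_of_strictlyKPositive hb hbo y' hy'0 hy'pos
  -- transport data of a band test family
  have htrans : ∀ (m : ℕ) (g : Fin m → UnitAddTorus (Fin 3) → EuclideanSpace ℝ (Fin 3)),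
      (∀ i, IsBandTest N (g i)) → ∀ P : MvPolynomial (Fin m) ℝ,
      (∀ u : Torus.energySpace (Fin 3), eval (fun j => Torus.pairing u.1 (g j)) P =
        eval (fun i => Torus.pairing u.1 (b i))
          (bind₁ (fun j => ∑ i, C (∫ y, ⟪g j y, b i y⟫_ℝ) * (X i : MvPolynomial (Fin n) ℝ)) P)) ∧
      (∀ u : Torus.energySpace (Fin 3), polyGrad g P u =
        polyGrad b (bind₁ (fun j => ∑ i, C (∫ y, ⟪g j y, b i y⟫_ℝ) * (X i : MvPolynomial (Fin n) ℝ)) P) u) :=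
    fun m g hg P =>
      ⟨fun u => eval_pairing_transport (fun j i => ∫ y, ⟪g j y, b i y⟫_ℝ)
          (fun u j => pairing_band_eq_sum hb hbs (hg j) u) P u,
        fun u => funext fun x => polyGrad_transport (fun j i => ∫ y, ⟪g j y, b i y⟫_ℝ)
          (fun j x => band_eq_sum_smul hbs (hg j) x) (fun u j => pairing_band_eq_sum hb hbs (hg j) u) P u x⟩
  refine ⟨μ₂, hp₂, hl₂, hi₂, ?_, ?_, ?_, ?_, ?_⟩
  · -- SLATER in degree 4, band form
    intro m g P hg hP4 hnn hex
    obtain ⟨hev, -⟩ := htrans m g hg P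
    obtain ⟨P', hP'⟩ : ∃ P' : MvPolynomial (Fin n) ℝ,
        P' = bind₁ (fun j => ∑ i, C (∫ y, ⟪g j y, b i y⟫_ℝ) * (X i : MvPolynomial (Fin n) ℝ)) P :=
      ⟨_, rfl⟩
    rw [← hP'] at hev
    have hdeg : P'.totalDegree ≤ 4 := by
      rw [hP']
      exact (totalDegree_bind₁_linear_le _ P).trans hP4
    have hpos : 0 < rieszFunctional y' P' := by
      refine hy'pos.2 P' hdeg (fun x _ => ?_) ?_
      · obtain ⟨u, hu, hux⟩ := hlev x
        rw [← hux, ← hev u]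
        exact hnn u hu
      · obtain ⟨u, hu, hne⟩ := hex
        exact ⟨_, Set.mem_univ _, by rw [← hev u]; exact hne⟩
    simp_rw [hev]
    rw [(hint P' hdeg).2]
    exact hpos
  · -- 3-STATIONARITY
    intro m g P hg hP3
    obtain ⟨-, hgrad⟩ := htrans m g hg P
    obtain ⟨P', hP'⟩ : ∃ P' : MvPolynomial (Fin n) ℝ,
        P' = bind₁ (fun j => ∑ i, C (∫ y, ⟪g j y, b i y⟫_ℝ) * (X i : MvPolynomial (Fin n) ℝ)) P :=
      ⟨_, rfl⟩
    rw [← hP'] at hgrad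
    have hdeg : P'.totalDegree ≤ 2 := by
      rw [hP']
      exact (totalDegree_bind₁_linear_le _ P).trans (by omega)
    have hsplit : ∀ u : Torus.energySpace (Fin 3), IsLevel N u →
        Torus.nsGeneratorPairing ν f u (polyGrad g P u) =
          eval (fun i => Torus.pairing u.1 (b i)) (∑ i, pderiv i P' * (R₀ i + R₁ i + R₂ i)) :=
      fun u hu => by rw [hgrad u, hrowR P' u hu]
    have hRdeg : (∑ i, pderiv i P' * (R₀ i + R₁ i + R₂ i)).totalDegree ≤ 4 :=
      (hRwdeg P' 1 (hdeg.trans (by norm_num))).trans (by norm_num)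
    refine ⟨(hint _ hRdeg).1.congr (hl₂.mono fun u hu => (hsplit u hu).symm), ?_⟩
    rw [integral_congr_ae (hl₂.mono fun u hu => hsplit u hu), (hint _ hRdeg).2]
    -- split `P' = P₂ + P₁` into its quadratic part and a part of degree `≤ 1`
    have hP₂h : (homogeneousComponent 2 P').IsHomogeneous 2 := homogeneousComponent_isHomogeneous 2 P'
    have hP₁d : (P' - homogeneousComponent 2 P').totalDegree ≤ 1 :=
      totalDegree_sub_homogeneousComponent_two_le P' hdeg
    have hPsum : P' = homogeneousComponent 2 P' + (P' - homogeneousComponent 2 P') :=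
      (add_sub_cancel _ _).symm
    have hRw : (∑ i, pderiv i P' * (R₀ i + R₁ i + R₂ i)) =
        (∑ i, pderiv i (homogeneousComponent 2 P') * (R₀ i + R₁ i + R₂ i)) +
          ∑ i, pderiv i (P' - homogeneousComponent 2 P') * (R₀ i + R₁ i + R₂ i) := by
      rw [← sum_pderiv_mul_add, ← hPsum]
    have hRw1 : (∑ i, pderiv i (P' - homogeneousComponent 2 P') * (R₀ i + R₁ i + R₂ i)).totalDegree ≤ 2 := by
      refine totalDegree_finsetSum_le fun i _ => ?_
      rw [pderiv_eq_C_of_totalDegree_le_one _ hP₁d i]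
      exact (totalDegree_mul _ _).trans (by rw [totalDegree_C, zero_add]; exact hRdeg2 i)
    have h1 : rieszFunctional y' (∑ i, pderiv i P' * (R₀ i + R₁ i + R₂ i)) =
        rieszFunctional y (∑ i, pderiv i P' * (R₀ i + R₁ i + R₂ i)) := by
      rw [hRw, rieszFunctional_add, rieszFunctional_add, hquad _ hP₂h, hrow2 _ hP₂h,
        rieszFunctional_congr_of_totalDegree_le (k := 2) hy'eq hRw1]
    rw [h1, ← (hmom _ hRdeg).2, ← integral_congr_ae (hl₁.mono fun u hu => hsplit u hu)]
    exact (hst m g P hg hP3).2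
  · -- CUBIC-CASIMIR ROWS
    intro m g P hg hP hC
    obtain ⟨-, hgrad⟩ := htrans m g hg P
    obtain ⟨P', hP'⟩ : ∃ P' : MvPolynomial (Fin n) ℝ,
        P' = bind₁ (fun j => ∑ i, C (∫ y, ⟪g j y, b i y⟫_ℝ) * (X i : MvPolynomial (Fin n) ℝ)) P :=
      ⟨_, rfl⟩
    rw [← hP'] at hgrad
    have hP'h : P'.IsHomogeneous 3 := by
      rw [hP']
      exact isHomogeneous_bind₁_linear _ hP
    have hE : (∑ i, pderiv i P' * R₂ i) = 0 := by
      refine MvPolynomial.funext fun x => ?_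
      obtain ⟨u, hu, hux⟩ := hlev x
      rw [map_zero, ← hux, ← heulR P' u hu, ← hgrad u]
      exact hC u hu
    have hsplit : ∀ u : Torus.energySpace (Fin 3), IsLevel N u →
        Torus.nsGeneratorPairing ν f u (polyGrad g P u) =
          eval (fun i => Torus.pairing u.1 (b i)) (∑ i, pderiv i P' * (R₀ i + R₁ i + R₂ i)) :=
      fun u hu => by rw [hgrad u, hrowR P' u hu]
    have hRdeg : (∑ i, pderiv i P' * (R₀ i + R₁ i + R₂ i)).totalDegree ≤ 4 :=
      hRwdeg P' 2 hP'h.totalDegree_le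
    refine ⟨(hint _ hRdeg).1.congr (hl₂.mono fun u hu => (hsplit u hu).symm), ?_⟩
    rw [integral_congr_ae (hl₂.mono fun u hu => hsplit u hu), (hint _ hRdeg).2]
    exact hcubic P' hP'h hE
  · -- ENERGY
    have hev : ∀ u : Torus.energySpace (Fin 3), IsLevel N u →
        ‖u‖ ^ 2 = eval (fun i => Torus.pairing u.1 (b i)) (∑ i, (X i : MvPolynomial (Fin n) ℝ) ^ 2) :=
      fun u hu => by rw [norm_sq_eq_sum_sq_coords hb hbo hbs u hu]; simp [map_sum]
    unfold Torus.ensembleEnergy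
    rw [integral_congr_ae (hl₂.mono fun u hu => hev u hu), integral_congr_ae (hl₁.mono fun u hu => hev u hu),
      (hint _ ((totalDegree_sum_X_sq_le n).trans (by norm_num))).2,
      (hmom _ ((totalDegree_sum_X_sq_le n).trans (by norm_num))).2]
    exact rieszFunctional_congr_of_totalDegree_le (k := 2) hy'eq (totalDegree_sum_X_sq_le n)
  · -- DISSIPATION
    obtain ⟨D, hDdeg, hD⟩ := exists_gradNormSq_poly hbs'
    have hD' : ∀ u : Torus.energySpace (Fin 3), IsLevel N u →
        (Torus.eGradNormSq (u.1 : UnitAddTorus (Fin 3) → EuclideanSpace ℝ (Fin 3))).toReal =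
          eval (fun i => Torus.pairing u.1 (b i)) D :=
      fun u hu => hD _ _ (coe_ae_eq_sum_of_level hbs u hu)
    unfold Torus.ensembleDissipation Torus.ensembleEnstrophy
    rw [toReal_lintegral_eGradNormSq_eq D hD' μ₂ hl₂ (hint D (hDdeg.trans (by norm_num))).1,
      toReal_lintegral_eGradNormSq_eq D hD' μ₁ hl₁ (hmom D (hDdeg.trans (by norm_num))).1,
      (hint D (hDdeg.trans (by norm_num))).2, (hmom D (hDdeg.trans (by norm_num))).2,
      rieszFunctional_congr_of_totalDegree_le (k := 2) hy'eq hDdeg]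

/-! ## The registered stub -/

/-- **S7 — CUBIC-ROW SURGERY: a second third-moment shift kills the row of every cubic Casimir.**
Let `μ₁` be a level-`N` probability law with finite fourth moments, SLATER at degree `4`, 3-STATIONARY
for Galerkin NS at `(ν, f, N)` (`f` smooth, `ν ≠ 0`), at a level where no dissipative tower exists
(hypothesis T of the line `dissipative-tower`, verbatim). Then there is a level-`N` probability law `μ₂`
with finite fourth moments, Slater at degree `4`, 3-stationary, with the SAME mean energy and
dissipation, such that additionally `∫ row dμ₂ = 0` (integrable) for every homogeneous cubic band
observable that is a Casimir of level-`N` Galerkin–Euler. Proof: `cubicRowSurgery_basis` in an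
orthonormal band basis (`exists_bandBasis`), the no-tower hypothesis specialised to tests over the
basis. (Registered stub of the crux skeleton `Cruxes/QuarticGate/Lines/dissipative_tower_core.lean`.)
[folklore] -/
theorem stub_cubicRowSurgery :
    ∀ (ν : ℝ) (f : UnitAddTorus (Fin 3) → EuclideanSpace ℝ (Fin 3)) (N : ℕ)
      (μ₁ : Measure (Torus.energySpace (Fin 3))),
    ν ≠ 0 → Torus.IsSmooth f →
    IsProbabilityMeasure μ₁ → (∀ᵐ u ∂μ₁, IsLevel N u) →
    Integrable (fun u : Torus.energySpace (Fin 3) => ‖u‖ ^ 4) μ₁ →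
    (∀ (m : ℕ) (g : Fin m → UnitAddTorus (Fin 3) → EuclideanSpace ℝ (Fin 3))
      (P : MvPolynomial (Fin m) ℝ), (∀ i, IsBandTest N (g i)) → P.totalDegree ≤ 4 →
      (∀ u : Torus.energySpace (Fin 3), IsLevel N u →
        0 ≤ MvPolynomial.eval (fun j => Torus.pairing u.1 (g j)) P) →
      (∃ u : Torus.energySpace (Fin 3), IsLevel N u ∧
        MvPolynomial.eval (fun j => Torus.pairing u.1 (g j)) P ≠ 0) →
      0 < ∫ u, MvPolynomial.eval (fun j => Torus.pairing u.1 (g j)) P ∂μ₁) →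
    IsPolyStationary ν f N 3 μ₁ →
    (∀ (m : ℕ) (g : Fin m → UnitAddTorus (Fin 3) → EuclideanSpace ℝ (Fin 3))
      (P : MvPolynomial (Fin m) ℝ), (∀ i, IsBandTest N (g i)) → P.IsHomogeneous 3 →
      (∀ u : Torus.energySpace (Fin 3), IsLevel N u →
        Torus.nsGeneratorPairing (d := Fin 3) 0 0 u (polyGrad g P u) = 0) →
      ∀ (m' : ℕ) (g' : Fin m' → UnitAddTorus (Fin 3) → EuclideanSpace ℝ (Fin 3))
        (Q : MvPolynomial (Fin m') ℝ), (∀ i, IsBandTest N (g' i)) →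
        (∀ u : Torus.energySpace (Fin 3), IsLevel N u →
          Torus.nsGeneratorPairing (d := Fin 3) 0 0 u (polyGrad g' Q u) =
            Torus.nsGeneratorPairing (d := Fin 3) ν 0 u (polyGrad g P u)) →
      ∀ u : Torus.energySpace (Fin 3), IsLevel N u →
        MvPolynomial.eval (fun j => Torus.pairing u.1 (g j)) P = 0) →
    ∃ μ₂ : Measure (Torus.energySpace (Fin 3)), IsProbabilityMeasure μ₂ ∧ (∀ᵐ u ∂μ₂, IsLevel N u) ∧
      Integrable (fun u : Torus.energySpace (Fin 3) => ‖u‖ ^ 4) μ₂ ∧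
      (∀ (m : ℕ) (g : Fin m → UnitAddTorus (Fin 3) → EuclideanSpace ℝ (Fin 3))
        (P : MvPolynomial (Fin m) ℝ), (∀ i, IsBandTest N (g i)) → P.totalDegree ≤ 4 →
        (∀ u : Torus.energySpace (Fin 3), IsLevel N u →
          0 ≤ MvPolynomial.eval (fun j => Torus.pairing u.1 (g j)) P) →
        (∃ u : Torus.energySpace (Fin 3), IsLevel N u ∧
          MvPolynomial.eval (fun j => Torus.pairing u.1 (g j)) P ≠ 0) →
        0 < ∫ u, MvPolynomial.eval (fun j => Torus.pairing u.1 (g j)) P ∂μ₂) ∧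
      IsPolyStationary ν f N 3 μ₂ ∧
      (∀ (m : ℕ) (g : Fin m → UnitAddTorus (Fin 3) → EuclideanSpace ℝ (Fin 3))
        (P : MvPolynomial (Fin m) ℝ), (∀ i, IsBandTest N (g i)) → P.IsHomogeneous 3 →
        (∀ u : Torus.energySpace (Fin 3), IsLevel N u →
          Torus.nsGeneratorPairing (d := Fin 3) 0 0 u (polyGrad g P u) = 0) →
        Integrable (fun u : Torus.energySpace (Fin 3) =>
          Torus.nsGeneratorPairing ν f u (polyGrad g P u)) μ₂ ∧
        ∫ u, Torus.nsGeneratorPairing ν f u (polyGrad g P u) ∂μ₂ = 0) ∧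
      Torus.ensembleEnergy μ₂ = Torus.ensembleEnergy μ₁ ∧
      Torus.ensembleDissipation ν μ₂ = Torus.ensembleDissipation ν μ₁ := by
  intro ν f N μ₁ _hν hf hp₁ hl₁ h4 hSl hst hT
  obtain ⟨n, b, hb, hbo, hbs⟩ := exists_bandBasis N
  haveI := hp₁
  exact cubicRowSurgery_basis hb hbo hbs ν hf μ₁ hl₁ h4 hSl hst
    fun P Q _hP hQ hcas htow => hT n b Q hb hQ hcas n b P hb htow

end Summit.AnomalousDissipation.AnomalousDissipation.Theorems.QuarticLadderQuarticGate
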